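import Literature.AlgebraicTopology.SingularHomology.UniverseTransport
import Literature.AlgebraicTopology.SingularHomology.RelativeUniverseTransport
import Literature.AlgebraicTopology.SingularHomology.ChainSubcomplex
import Literature.AlgebraicTopology.SingularHomology.ExcisionTheorem
import Literature.AlgebraicTopology.SingularHomology.Orientation
import HarnessLib

/-!
# Singular homology along homeomorphisms across universes: the comparison isomorphisms

For a homeomorphism `e : X ≃ₜ Y` between spaces `X : Type u` and `Y : Type u'` in *different*
universes, `Hₙ(X; M) : ModuleCat.{max u v} R` and `Hₙ(Y; M) : ModuleCat.{max u' v} R` live in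
different categories and the induced chain map `e♯` is not available (`…UniverseTransport`
transports only the *vanishing* of homology, and notes that "a universe-changing comparison
isomorphism … is not attempted").  Here we construct the comparison as `R`-linear equivalences of
the underlying modules, natural in the pair of spaces, for absolute, relative and local homology
(A. Hatcher, *Algebraic Topology* (2002), §2.1: a homeomorphism induces an isomorphism of singular
chain complexes, hence of homology; "Exact sequences and excision" for pairs; §3.3 p. 231 for
`Hₙ(X | x)`).

Part I is pure homological algebra: for complexes of `R`-modules
`K : HomologicalComplex (ModuleCat.{w} R) c`, `K' : HomologicalComplex (ModuleCat.{w'} R) c` in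
module categories of different universes no chain map `K ⟶ K'` can be written down, yet
degreewise linear equivalences commuting with the differentials induce linear equivalences
`Hᵢ(K) ≃ₗ[R] Hᵢ(K')` ("isomorphic chain complexes have isomorphic homology", Hatcher §2.1),
constructed through the explicit model `H(S) ≅ ker g ⧸ im f` (Mathlib's
`ShortComplex.moduleCatHomologyIso`) and the cycle/class dictionary `scHomologyCls` /
`homologyCls` of `…ChainSubcomplex`:

* `ShortComplexXEquiv S S'`, `ComplexXEquiv K K'` — degreewise linear equivalences commuting
  with the structure maps ("cross-universe isomorphisms"), with `refl`/`symm`/`trans`;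
* `ShortComplexXEquiv.homologyEquiv`, `ComplexXEquiv.homologyEquiv` — the induced equivalences
  on homology, computed on classes by `[z] ↦ [e z]` (`homologyEquiv_scHomologyCls`,
  `homologyEquiv_homologyCls`) and natural for chain maps on both sides intertwined by the
  equivalences (`homologyEquiv_homologyMap`).

Part II, singular homology:

* `SingularSimplex.pushEquiv n e : Δₙ(X) ≃ Δₙ(Y)` (composition with `e`, `SingularSimplex.push`
  of `…UniverseTransport`), `CChain.pushEquiv R M e n : Cₙ(X; M) ≃ₗ[R] Cₙ(Y; M)`
  (`Finsupp.domLCongr`), assembling to `csingularChainComplex.xEquiv` (a `ComplexXEquiv`, chain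
  map property by `CChain.bd_push`);
* `csingularHomology.xEquiv`, `singularHomology.xEquiv R M e n : Hₙ(X; M) ≃ₗ[R] Hₙ(Y; M)`,
  natural for squares `g ∘ e = e₂ ∘ f` of continuous maps (`xEquiv_map`), and the transport of
  vanishing in both directions (`isZero_iff_of_homeomorph`);
* `relativeSingularHomology.xEquiv R M e hAB hBA n : Hₙ(X, A; M) ≃ₗ[R] Hₙ(Y, B; M)` for
  `e(A) = B` (through the concrete quotient complexes `C(X)/C(A)`, `concreteIso` of
  `…RelativeCapProduct`, and `Submodule.Quotient.equiv` degreewise), natural for maps of pairs;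
* `localHomologyOfSet.xEquiv`, `localHomology.xEquiv R M e x n : Hₙ(X | x; M) ≃ₗ[R] Hₙ(Y | e x; M)`,
  compatible with the restriction maps (`xEquiv_restrictLocal`, `xEquiv_restrictToPoint`).

Everything is proved; nothing is asserted.  The consumer `…LocalHomologyUniverse` derives the
local homology of topological manifolds in every universe from the computations of
`…LocalHomologyVanishing` / `…LocalHomologyIso` in `Type`.

## References

* A. Hatcher, *Algebraic Topology*, CUP 2002, §2.1 (chain complexes, induced chain maps, pairs),
  §3.3 p. 231, p. 233. [HatcherAT2002]

## Design notes

* As in `…SingularChainsConcrete` / `…UniverseTransport`, `backward.isDefEq.respectTransparency`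
  is turned off in Part II (chains of the concrete complex are `Finsupp`s up to unfolding).
* `H(S)` is compared with the quotient `ker g ⧸ im` through `homologyQuotEquiv`, a linear
  equivalence onto the quotient *with its own instances* (rather than those of `ModuleCat.of`),
  so that rewriting lemmas about `Submodule.Quotient` apply.
-/

noncomputable section

open CategoryTheory Limits Set

universe u u' v w w' w'' t

namespace Literature.AlgebraicTopology.SingularHomology

/-! ## Part I — Transport of homology along degreewise linear equivalences across universes -/

section PartI

variable {R : Type v} [CommRing R]

/-! ### Short complexes of modules -/

/-- A **cross-universe isomorphism of short complexes of `R`-modules**: linear equivalences in the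
three degrees commuting with `f` and `g` (the two complexes may live in `ModuleCat` of different
universes, where no morphism between them exists). [folklore] -/
structure ShortComplexXEquiv (S : ShortComplex (ModuleCat.{w} R))
    (S' : ShortComplex (ModuleCat.{w'} R)) where
  /-- the equivalence in degree `1` -/
  e₁ : S.X₁ ≃ₗ[R] S'.X₁
  /-- the equivalence in degree `2` -/
  e₂ : S.X₂ ≃ₗ[R] S'.X₂
  /-- the equivalence in degree `3` -/
  e₃ : S.X₃ ≃ₗ[R] S'.X₃
  /-- compatibility with `f` -/
  comm₁₂ : ∀ x, e₂ (S.f x) = S'.f (e₁ x)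
  /-- compatibility with `g` -/
  comm₂₃ : ∀ x, e₃ (S.g x) = S'.g (e₂ x)

namespace ShortComplexXEquiv

variable {S : ShortComplex (ModuleCat.{w} R)} {S' : ShortComplex (ModuleCat.{w'} R)}
  (E : ShortComplexXEquiv S S')

/-- `e₂` carries cycles onto cycles. [folklore] -/
lemma map_ker : (LinearMap.ker S.g.hom).map (E.e₂ : S.X₂ →ₗ[R] S'.X₂) = LinearMap.ker S'.g.hom := by
  ext y
  constructor
  · rintro ⟨x, hx, rfl⟩
    have hx' : S.g x = 0 := hx
    show S'.g (E.e₂ x) = 0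
    rw [← E.comm₂₃, hx', map_zero]
  · intro hy
    have hy' : S'.g y = 0 := hy
    refine ⟨E.e₂.symm y, ?_, E.e₂.apply_symm_apply y⟩
    show S.g (E.e₂.symm y) = 0
    apply E.e₃.injective
    rw [map_zero, E.comm₂₃, LinearEquiv.apply_symm_apply, hy']

/-- The induced equivalence of cycle modules `ker g ≃ ker g'`. [folklore] -/
def kerEquiv : LinearMap.ker S.g.hom ≃ₗ[R] LinearMap.ker S'.g.hom :=
  (E.e₂.submoduleMap (LinearMap.ker S.g.hom)).trans (LinearEquiv.ofEq _ _ E.map_ker)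

/-- `kerEquiv` is `e₂` on underlying elements. [folklore] -/
@[simp]
lemma kerEquiv_apply_coe (z : LinearMap.ker S.g.hom) : (E.kerEquiv z : S'.X₂) = E.e₂ z := rfl

/-- `e₂` carries boundaries onto boundaries (inside the cycles). [folklore] -/
lemma map_range_toCycles :
    (LinearMap.range S.moduleCatToCycles).map (E.kerEquiv : _ →ₗ[R] _) =
      LinearMap.range S'.moduleCatToCycles := by
  ext y
  constructor
  · rintro ⟨z, ⟨x, rfl⟩, rfl⟩
    refine ⟨E.e₁ x, Subtype.ext ?_⟩
    show S'.f (E.e₁ x) = E.e₂ (S.f x)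
    rw [E.comm₁₂]
  · rintro ⟨x', rfl⟩
    refine ⟨S.moduleCatToCycles (E.e₁.symm x'), ⟨_, rfl⟩, Subtype.ext ?_⟩
    show E.e₂ (S.f (E.e₁.symm x')) = S'.f x'
    rw [E.comm₁₂, LinearEquiv.apply_symm_apply]

/-- Mathlib's `H(S) ≅ ker g ⧸ im (X₁ → ker g)` (`ShortComplex.moduleCatHomologyIso`) as a linear
equivalence onto the quotient module with its own instances. [folklore] -/
def homologyQuotEquiv (S : ShortComplex (ModuleCat.{w} R)) :
    S.homology ≃ₗ[R] (LinearMap.ker S.g.hom ⧸ LinearMap.range S.moduleCatToCycles) :=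
  S.moduleCatHomologyIso.toLinearEquiv

/-- `homologyQuotEquiv [z]` is the residue class of the cycle `z`. [folklore] -/
lemma homologyQuotEquiv_scHomologyCls (z : S.X₂) (hz : S.g z = 0) :
    homologyQuotEquiv S (scHomologyCls z hz) =
      Submodule.Quotient.mk (⟨z, hz⟩ : LinearMap.ker S.g.hom) :=
  moduleCatHomologyIso_hom_scHomologyCls z hz

/-- **The induced equivalence on homology** `H(S) ≃ₗ[R] H(S')`, through
`H ≅ ker g ⧸ im (X₁ → ker g)` on both sides (Hatcher 2002, §2.1). [cite: HatcherAT2002, §2.1] -/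
def homologyEquiv : S.homology ≃ₗ[R] S'.homology :=
  homologyQuotEquiv S ≪≫ₗ
    (Submodule.Quotient.equiv _ _ E.kerEquiv E.map_range_toCycles ≪≫ₗ (homologyQuotEquiv S').symm)

/-- `e₂` of a cycle is a cycle. [folklore] -/
lemma g_e₂_eq_zero {z : S.X₂} (hz : S.g z = 0) : S'.g (E.e₂ z) = 0 := by
  rw [← E.comm₂₃, hz, map_zero]

/-- **The homology equivalence on classes: `[z] ↦ [e₂ z]`.** [folklore] -/
lemma homologyEquiv_scHomologyCls (z : S.X₂) (hz : S.g z = 0) (hz' : S'.g (E.e₂ z) = 0) :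
    E.homologyEquiv (scHomologyCls z hz) = scHomologyCls (E.e₂ z) hz' := by
  simp only [homologyEquiv, LinearEquiv.trans_apply]
  rw [LinearEquiv.symm_apply_eq, homologyQuotEquiv_scHomologyCls, homologyQuotEquiv_scHomologyCls]
  rfl

end ShortComplexXEquiv

/-! ### Homological complexes of modules -/

section Complexes

variable {ι : Type t} {c : ComplexShape ι}

/-- A **cross-universe isomorphism of complexes of `R`-modules**: degreewise linear equivalences
commuting with the differentials (Hatcher 2002, §2.1, "isomorphism of chain complexes"; the two
complexes may live in `ModuleCat` of different universes). [folklore] -/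
structure ComplexXEquiv (K : HomologicalComplex (ModuleCat.{w} R) c)
    (K' : HomologicalComplex (ModuleCat.{w'} R) c) where
  /-- the degreewise equivalences -/
  e : ∀ i, K.X i ≃ₗ[R] K'.X i
  /-- compatibility with the differentials -/
  comm : ∀ i j (x : K.X i), e j (K.d i j x) = K'.d i j (e i x)

namespace ComplexXEquiv

variable {K : HomologicalComplex (ModuleCat.{w} R) c} {K' : HomologicalComplex (ModuleCat.{w'} R) c}
  {K'' : HomologicalComplex (ModuleCat.{w''} R) c}
  (E : ComplexXEquiv K K')

/-- The identity. [folklore] -/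
def refl (K : HomologicalComplex (ModuleCat.{w} R) c) : ComplexXEquiv K K where
  e _ := LinearEquiv.refl R _
  comm _ _ _ := rfl

/-- The inverse. [folklore] -/
def symm : ComplexXEquiv K' K where
  e i := (E.e i).symm
  comm i j x := by
    apply (E.e j).injective
    rw [LinearEquiv.apply_symm_apply, E.comm, LinearEquiv.apply_symm_apply]

/-- Composition. [folklore] -/
def trans (F : ComplexXEquiv K' K'') : ComplexXEquiv K K'' where
  e i := (E.e i).trans (F.e i)
  comm i j x := by
    rw [LinearEquiv.trans_apply, LinearEquiv.trans_apply, E.comm, F.comm]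

/-- The induced cross-universe isomorphism of the short complexes `K.sc i`. [folklore] -/
def sc (i : ι) : ShortComplexXEquiv (K.sc i) (K'.sc i) where
  e₁ := E.e (c.prev i)
  e₂ := E.e i
  e₃ := E.e (c.next i)
  comm₁₂ x := E.comm _ _ x
  comm₂₃ x := E.comm _ _ x

/-- **The induced equivalence on homology** `Hᵢ(K) ≃ₗ[R] Hᵢ(K')` (Hatcher 2002, §2.1:
isomorphic chain complexes have isomorphic homology). [cite: HatcherAT2002, §2.1] -/
def homologyEquiv (i : ι) : K.homology i ≃ₗ[R] K'.homology i :=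
  (E.sc i).homologyEquiv

/-- The image of a cycle is a cycle. [folklore] -/
lemma d_e_eq_zero {i : ι} {z : K.X i} (hz : K.d i (c.next i) z = 0) :
    K'.d i (c.next i) (E.e i z) = 0 := by
  rw [← E.comm, hz, map_zero]

/-- **On classes: `[z] ↦ [e z]`.** [folklore] -/
lemma homologyEquiv_homologyCls {i : ι} (z : K.X i) (hz : K.d i (c.next i) z = 0)
    (hz' : K'.d i (c.next i) (E.e i z) = 0) :
    E.homologyEquiv i (homologyCls z hz) = homologyCls (E.e i z) hz' :=
  (E.sc i).homologyEquiv_scHomologyCls z hz hz'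

/-- **Naturality**: chain maps `f : K ⟶ L`, `f' : K' ⟶ L'` intertwined degreewise by cross-universe
isomorphisms `E : K ≅ K'`, `F : L ≅ L'` induce maps on homology intertwined by the homology
equivalences (Hatcher 2002, §2.1, functoriality). [folklore] -/
theorem homologyEquiv_homologyMap {L : HomologicalComplex (ModuleCat.{w} R) c}
    {L' : HomologicalComplex (ModuleCat.{w'} R) c} (F : ComplexXEquiv L L') (f : K ⟶ L)
    (f' : K' ⟶ L') (hf : ∀ i (x : K.X i), F.e i (f.f i x) = f'.f i (E.e i x)) (i : ι)
    (x : K.homology i) :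
    F.homologyEquiv i (HomologicalComplex.homologyMap f i x) =
      HomologicalComplex.homologyMap f' i (E.homologyEquiv i x) := by
  obtain ⟨z, hz, rfl⟩ := homologyCls_surjective x
  rw [homologyMap_homologyCls f z hz,
    F.homologyEquiv_homologyCls _ _ (F.d_e_eq_zero (d_hom_f_eq_zero f z hz)),
    E.homologyEquiv_homologyCls z hz (E.d_e_eq_zero hz), homologyMap_homologyCls f' _ _]
  exact homologyCls_congr (hf i z) _ _

/-- The homology equivalence of the inverse is the inverse. [folklore] -/
lemma homologyEquiv_symm_apply (i : ι) (y : K'.homology i) :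
    E.symm.homologyEquiv i y = (E.homologyEquiv i).symm y := by
  apply (E.homologyEquiv i).injective
  rw [LinearEquiv.apply_symm_apply]
  obtain ⟨z, hz, rfl⟩ := homologyCls_surjective y
  rw [E.symm.homologyEquiv_homologyCls z hz (E.symm.d_e_eq_zero hz),
    E.homologyEquiv_homologyCls _ _ (E.d_e_eq_zero (E.symm.d_e_eq_zero hz))]
  exact homologyCls_congr ((E.e i).apply_symm_apply z) _ _

end ComplexXEquiv

end Complexes

end PartI

/-! ## Part II — Singular homology along homeomorphisms across universes -/

section PartII

-- as in `SingularChainsConcrete` / `UniverseTransport`: chains of the concrete complex are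
-- `Finsupp`s up to unfolding
set_option backward.isDefEq.respectTransparency false

variable (R : Type v) [CommRing R] (M : Type v) [AddCommGroup M] [Module R M]
variable {X : Type u} {Y : Type u'} [TopologicalSpace X] [TopologicalSpace Y]

/-! ### Simplices and chains -/

namespace SingularSimplex

variable {n : ℕ}

-- `SingularSimplex.range_push` (the image of `ρ.push f = f ∘ ρ` is `f (image of ρ)`) is the
-- lemma of `RelativeUniverseTransport.lean` (imported; formerly duplicated here).

omit R M in
/-- A map of pairs pushes simplices in `A` to simplices in `B`. [folklore] -/
lemma push_mem_simplicesIn (f : C(X, Y)) {A : Set X} {B : Set Y} (h : MapsTo f A B)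
    {ρ : SingularSimplex X n} (hρ : ρ ∈ simplicesIn X A n) : ρ.push f ∈ simplicesIn Y B n := by
  rw [mem_simplicesIn, range_push]
  exact (image_mono hρ).trans h.image_subset

variable (n) in
omit R M in
/-- **Singular simplices along a homeomorphism across universes**: `ρ ↦ e ∘ ρ` is a bijection
`Δₙ(X) ≃ Δₙ(Y)` (Hatcher 2002, §2.1). [folklore] -/
def pushEquiv (e : X ≃ₜ Y) : SingularSimplex X n ≃ SingularSimplex Y n where
  toFun := push (e : C(X, Y))
  invFun := push (e.symm : C(Y, X))
  left_inv := push_push_symm e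
  right_inv ρ := by simpa using push_push_symm e.symm ρ

omit R M in
/-- `pushEquiv e` is `push e` on elements. [folklore] -/
@[simp]
lemma pushEquiv_apply (e : X ≃ₜ Y) (ρ : SingularSimplex X n) :
    pushEquiv n e ρ = ρ.push (e : C(X, Y)) := rfl

end SingularSimplex

/-- **Concrete singular chains along a homeomorphism across universes**:
`Cₙ(X; M) ≃ₗ[R] Cₙ(Y; M)` (`Finsupp.domLCongr` of `SingularSimplex.pushEquiv`; Hatcher 2002,
§2.1). [folklore] -/
def CChain.pushEquiv (e : X ≃ₜ Y) (n : ℕ) : CChain M X n ≃ₗ[R] CChain M Y n :=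
  Finsupp.domLCongr (SingularSimplex.pushEquiv n e)

/-- `CChain.pushEquiv e` is the push-forward `e♯` of `…UniverseTransport`. [folklore] -/
@[simp]
lemma CChain.pushEquiv_apply (e : X ≃ₜ Y) (n : ℕ) (c : CChain M X n) :
    CChain.pushEquiv R M e n c = CChain.push R M (e : C(X, Y)) n c := by
  refine Finsupp.induction_linear c (by simp) (fun a b ha hb ↦ by rw [map_add, map_add, ha, hb])
    fun σ m ↦ ?_
  rw [CChain.pushEquiv, Finsupp.domLCongr_single, CChain.push_single]
  rfl

-- `CChain.push_mem_chainsIn` (`e♯` maps chains in `A` to chains in `B` for a map of pairs) is the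
-- lemma of `RelativeUniverseTransport.lean` (imported; formerly duplicated here).

/-- For `e(A) = B` (given as the two inclusions), `e♯` carries `Cₙ(A)` onto `Cₙ(B)`. [folklore] -/
lemma CChain.map_chainsIn_pushEquiv (e : X ≃ₜ Y) {A : Set X} {B : Set Y} (hAB : MapsTo e A B)
    (hBA : MapsTo e.symm B A) (n : ℕ) :
    (chainsIn R M X A n).map (CChain.pushEquiv R M e n : CChain M X n →ₗ[R] CChain M Y n) =
      chainsIn R M Y B n := by
  apply le_antisymm
  · rintro _ ⟨c, hc, rfl⟩
    rw [LinearEquiv.coe_coe, CChain.pushEquiv_apply]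
    exact CChain.push_mem_chainsIn R M (e : C(X, Y)) hAB hc
  · intro c hc
    refine ⟨CChain.push R M (e.symm : C(Y, X)) n c,
      CChain.push_mem_chainsIn R M (e.symm : C(Y, X)) hBA hc, ?_⟩
    rw [LinearEquiv.coe_coe, CChain.pushEquiv_apply]
    simpa using CChain.push_push_symm R M e.symm c

/-! ### The concrete chain complexes and their homology -/

namespace csingularChainComplex

/-- **The singular chain complexes of homeomorphic spaces in different universes are isomorphic**
(degreewise `CChain.pushEquiv`, a chain map by `CChain.bd_push`; Hatcher 2002, §2.1).
[cite: HatcherAT2002, §2.1] -/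
def xEquiv (e : X ≃ₜ Y) :
    ComplexXEquiv (csingularChainComplex R M X) (csingularChainComplex R M Y) where
  e n := CChain.pushEquiv R M e n
  comm i j c := by
    by_cases hij : (ComplexShape.down ℕ).Rel i j
    · have hij' : j + 1 = i := hij
      subst hij'
      change CChain.pushEquiv R M e j ((csingularChainComplex R M X).d (j + 1) j c) =
        (csingularChainComplex R M Y).d (j + 1) j (CChain.pushEquiv R M e (j + 1) c)
      rw [csingularChainComplex.d_apply, csingularChainComplex.d_apply, CChain.pushEquiv_apply,
        CChain.pushEquiv_apply, CChain.bd_push]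
    · rw [(csingularChainComplex R M X).shape _ _ hij, (csingularChainComplex R M Y).shape _ _ hij]
      simp

/-- The degreewise equivalence of `xEquiv e` is `e♯`. [folklore] -/
lemma xEquiv_e_apply (e : X ≃ₜ Y) (n : ℕ) (c : (csingularChainComplex R M X).X n) :
    (xEquiv R M e).e n c = CChain.push R M (e : C(X, Y)) n c :=
  CChain.pushEquiv_apply R M e n c

/-- `e♯` intertwines the chain maps of a commuting square `g ∘ e = e₂ ∘ f` of continuous maps
(Hatcher 2002, §2.1, functoriality of `f♯`). [folklore] -/
lemma push_map_f {X₂ : Type u} {Y₂ : Type u'} [TopologicalSpace X₂] [TopologicalSpace Y₂]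
    (e : X ≃ₜ Y) (e₂ : X₂ ≃ₜ Y₂) (f : C(X, X₂)) (g : C(Y, Y₂)) (hfg : ∀ x, g (e x) = e₂ (f x))
    (n : ℕ) (c : (csingularChainComplex R M X).X n) :
    CChain.push R M (e₂ : C(X₂, Y₂)) n ((csingularChainComplex.map R M f).f n c) =
      (csingularChainComplex.map R M g).f n (CChain.push R M (e : C(X, Y)) n c) := by
  rw [csingularChainComplex.map_f_apply, csingularChainComplex.map_f_apply]
  refine Finsupp.induction_linear c (by simp) (fun a b ha hb ↦ ?_) fun σ m ↦ ?_
  · rw [Finsupp.mapDomain_add, map_add, ha, hb, map_add, Finsupp.mapDomain_add]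
  · rw [Finsupp.mapDomain_single, CChain.push_single, CChain.push_single, Finsupp.mapDomain_single]
    congr 1
    apply SingularSimplex.toContinuousMap_injective
    rw [SingularSimplex.toContinuousMap_push, SingularSimplex.toContinuousMap_map,
      SingularSimplex.toContinuousMap_map, SingularSimplex.toContinuousMap_push]
    ext t
    exact (hfg _).symm

end csingularChainComplex

namespace csingularHomology

/-- **Concrete singular homology along a homeomorphism across universes**:
`Hₙ(X; M) ≃ₗ[R] Hₙ(Y; M)` (Hatcher 2002, §2.1). [cite: HatcherAT2002, §2.1] -/
def xEquiv (e : X ≃ₜ Y) (n : ℕ) : csingularHomology R M X n ≃ₗ[R] csingularHomology R M Y n :=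
  (csingularChainComplex.xEquiv R M e).homologyEquiv n

/-- On classes: `[z] ↦ [e♯ z]`. [folklore] -/
lemma xEquiv_homologyCls (e : X ≃ₜ Y) (n : ℕ) (z : (csingularChainComplex R M X).X n)
    (hz : (csingularChainComplex R M X).d n ((ComplexShape.down ℕ).next n) z = 0)
    (hz' : (csingularChainComplex R M Y).d n ((ComplexShape.down ℕ).next n)
      (CChain.push R M (e : C(X, Y)) n z) = 0) :
    xEquiv R M e n (homologyCls z hz) = homologyCls (CChain.push R M (e : C(X, Y)) n z) hz' := by
  have hz'' : (csingularChainComplex R M Y).d n ((ComplexShape.down ℕ).next n)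
      ((csingularChainComplex.xEquiv R M e).e n z) = 0 := by
    rw [csingularChainComplex.xEquiv_e_apply]
    exact hz'
  rw [xEquiv, (csingularChainComplex.xEquiv R M e).homologyEquiv_homologyCls z hz hz'']
  exact homologyCls_congr (csingularChainComplex.xEquiv_e_apply R M e n z) _ _

/-- **Naturality**: for a commuting square `g ∘ e = e₂ ∘ f` of continuous maps with `e`, `e₂`
homeomorphisms across universes, `xEquiv e₂ ∘ f_* = g_* ∘ xEquiv e` (Hatcher 2002, §2.1).
[folklore] -/
theorem xEquiv_map {X₂ : Type u} {Y₂ : Type u'} [TopologicalSpace X₂] [TopologicalSpace Y₂]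
    (e : X ≃ₜ Y) (e₂ : X₂ ≃ₜ Y₂) (f : C(X, X₂)) (g : C(Y, Y₂)) (hfg : ∀ x, g (e x) = e₂ (f x))
    (n : ℕ) (x : csingularHomology R M X n) :
    xEquiv R M e₂ n (csingularHomology.map R M f n x) =
      csingularHomology.map R M g n (xEquiv R M e n x) :=
  ComplexXEquiv.homologyEquiv_homologyMap _ _ _ _
    (fun i c ↦ by
      rw [csingularChainComplex.xEquiv_e_apply, csingularChainComplex.xEquiv_e_apply]
      exact csingularChainComplex.push_map_f R M e e₂ f g hfg i c) n x

end csingularHomology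

/-- Vanishing of a module object is invariant under linear equivalences across universes. [folklore] -/
lemma isZero_of_linearEquiv {A : ModuleCat.{u} R} {B : ModuleCat.{u'} R} (f : A ≃ₗ[R] B)
    (h : IsZero A) : IsZero B :=
  haveI := ModuleCat.subsingleton_of_isZero h
  haveI : Subsingleton B := f.symm.injective.subsingleton
  ModuleCat.isZero_of_subsingleton B

/-- `IsZero A ↔ IsZero B` for linearly equivalent module objects across universes. [folklore] -/
lemma isZero_iff_of_linearEquiv {A : ModuleCat.{u} R} {B : ModuleCat.{u'} R} (f : A ≃ₗ[R] B) :
    IsZero A ↔ IsZero B :=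
  ⟨isZero_of_linearEquiv R f, isZero_of_linearEquiv R f.symm⟩

namespace singularHomology

/-- **Singular homology along a homeomorphism across universes** (Mathlib's model, through
`csingularHomology.compIso`): `Hₙ(X; M) ≃ₗ[R] Hₙ(Y; M)` (Hatcher 2002, §2.1).
[cite: HatcherAT2002, §2.1] -/
def xEquiv (e : X ≃ₜ Y) (n : ℕ) : singularHomology R M X n ≃ₗ[R] singularHomology R M Y n :=
  (csingularHomology.compIso R M X n).symm.toLinearEquiv ≪≫ₗ
    (csingularHomology.xEquiv R M e n ≪≫ₗ (csingularHomology.compIso R M Y n).toLinearEquiv)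

/-- **Naturality** of `singularHomology.xEquiv` for commuting squares `g ∘ e = e₂ ∘ f`. [folklore] -/
theorem xEquiv_map {X₂ : Type u} {Y₂ : Type u'} [TopologicalSpace X₂] [TopologicalSpace Y₂]
    (e : X ≃ₜ Y) (e₂ : X₂ ≃ₜ Y₂) (f : C(X, X₂)) (g : C(Y, Y₂)) (hfg : ∀ x, g (e x) = e₂ (f x))
    (n : ℕ) (x : singularHomology R M X n) :
    xEquiv R M e₂ n (singularHomology.map R M f n x) =
      singularHomology.map R M g n (xEquiv R M e n x) := by
  simp only [xEquiv, LinearEquiv.trans_apply, Iso.toLinearEquiv_apply, Iso.symm_hom]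
  have h1' : singularHomology.map R M f n ≫ (csingularHomology.compIso R M X₂ n).inv =
      (csingularHomology.compIso R M X n).inv ≫ csingularHomology.map R M f n := by
    rw [Iso.comp_inv_eq, Category.assoc, csingularHomology.map_comp_compIso_hom,
      Iso.inv_hom_id_assoc]
  have h1 : (csingularHomology.compIso R M X₂ n).inv (singularHomology.map R M f n x) =
      csingularHomology.map R M f n ((csingularHomology.compIso R M X n).inv x) := by
    rw [← ModuleCat.comp_apply, ← ModuleCat.comp_apply, h1']
  rw [h1, csingularHomology.xEquiv_map R M e e₂ f g hfg, ← ModuleCat.comp_apply,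
    csingularHomology.map_comp_compIso_hom, ModuleCat.comp_apply]

/-- Vanishing of singular homology is invariant under homeomorphisms across universes, both
ways. [folklore] -/
theorem isZero_iff_of_homeomorph (e : X ≃ₜ Y) (n : ℕ) :
    IsZero (singularHomology R M X n) ↔ IsZero (singularHomology R M Y n) :=
  isZero_iff_of_linearEquiv R (xEquiv R M e n)

end singularHomology

/-! ### Relative homology -/

namespace relativeConcrete

/-- The degreewise equivalence `Cₙ(X)/Cₙ(A) ≃ₗ[R] Cₙ(Y)/Cₙ(B)` induced by `e♯` for `e(A) = B`
(`Submodule.Quotient.equiv`). [folklore] -/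
def eDeg (e : X ≃ₜ Y) {A : Set X} {B : Set Y} (hAB : MapsTo e A B) (hBA : MapsTo e.symm B A)
    (n : ℕ) : (chainsInSub R M X A).quotient.X n ≃ₗ[R] (chainsInSub R M Y B).quotient.X n :=
  Submodule.Quotient.equiv (chainsIn R M X A n) (chainsIn R M Y B n) (CChain.pushEquiv R M e n)
    (CChain.map_chainsIn_pushEquiv R M e hAB hBA n)

/-- `eDeg` on residue classes: `[c] ↦ [e♯ c]`. [folklore] -/
lemma eDeg_π (e : X ≃ₜ Y) {A : Set X} {B : Set Y} (hAB : MapsTo e A B) (hBA : MapsTo e.symm B A)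
    (n : ℕ) (c : (csingularChainComplex R M X).X n) :
    eDeg R M e hAB hBA n ((chainsInSub R M X A).π.f n c) =
      (chainsInSub R M Y B).π.f n (CChain.push R M (e : C(X, Y)) n c) := by
  rw [Subcomplex.π_f_apply, Subcomplex.π_f_apply, ← CChain.pushEquiv_apply]
  rfl

/-- **The relative chain complexes `C(X)/C(A)` and `C(Y)/C(B)` are isomorphic across universes**
for a homeomorphism `e : X ≃ₜ Y` with `e(A) = B` (degreewise `Submodule.Quotient.equiv` of `e♯`;
Hatcher 2002, §2.1, "Exact sequences and excision"). [cite: HatcherAT2002, §2.1] -/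
def xEquiv (e : X ≃ₜ Y) {A : Set X} {B : Set Y} (hAB : MapsTo e A B) (hBA : MapsTo e.symm B A) :
    ComplexXEquiv (chainsInSub R M X A).quotient (chainsInSub R M Y B).quotient where
  e n := eDeg R M e hAB hBA n
  comm i j x := by
    obtain ⟨x, rfl⟩ := (chainsInSub R M X A).π_f_surjective i x
    rw [Subcomplex.quotient_d_π_f, eDeg_π, eDeg_π, Subcomplex.quotient_d_π_f]
    congr 1
    have h := (csingularChainComplex.xEquiv R M e).comm i j x
    rwa [csingularChainComplex.xEquiv_e_apply, csingularChainComplex.xEquiv_e_apply] at h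

/-- The degreewise equivalence of `xEquiv` on residue classes: `[c] ↦ [e♯ c]`. [folklore] -/
lemma xEquiv_e_π (e : X ≃ₜ Y) {A : Set X} {B : Set Y} (hAB : MapsTo e A B)
    (hBA : MapsTo e.symm B A) (n : ℕ) (c : (csingularChainComplex R M X).X n) :
    (xEquiv R M e hAB hBA).e n ((chainsInSub R M X A).π.f n c) =
      (chainsInSub R M Y B).π.f n (CChain.push R M (e : C(X, Y)) n c) :=
  eDeg_π R M e hAB hBA n c

end relativeConcrete

namespace relativeSingularHomology

/-- **Relative singular homology along a homeomorphism of pairs across universes**: for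
`e : X ≃ₜ Y` with `e(A) = B`, `Hₙ(X, A; M) ≃ₗ[R] Hₙ(Y, B; M)` (through the concrete quotient
complexes, `relativeSingularHomology.concreteIso`; Hatcher 2002, §2.1). [cite: HatcherAT2002, §2.1] -/
def xEquiv (e : X ≃ₜ Y) {A : Set X} {B : Set Y} (hAB : MapsTo e A B) (hBA : MapsTo e.symm B A)
    (n : ℕ) : relativeSingularHomology R M X A n ≃ₗ[R] relativeSingularHomology R M Y B n :=
  (concreteIso R M X A n).toLinearEquiv ≪≫ₗ
    ((relativeConcrete.xEquiv R M e hAB hBA).homologyEquiv n ≪≫ₗ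
      (concreteIso R M Y B n).symm.toLinearEquiv)

/-- **Naturality for maps of pairs**: for a commuting square `g ∘ e = e₂ ∘ f` with
`f : (X, A) → (X₂, A₂)`, `g : (Y, B) → (Y₂, B₂)` maps of pairs and `e(A) = B`, `e₂(A₂) = B₂`,
`xEquiv e₂ ∘ f_* = g_* ∘ xEquiv e` (Hatcher 2002, §2.1). [folklore] -/
theorem xEquiv_map {X₂ : Type u} {Y₂ : Type u'} [TopologicalSpace X₂] [TopologicalSpace Y₂]
    (e : X ≃ₜ Y) (e₂ : X₂ ≃ₜ Y₂) (f : C(X, X₂)) (g : C(Y, Y₂)) (hfg : ∀ x, g (e x) = e₂ (f x))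
    {A : Set X} {B : Set Y} (hAB : MapsTo e A B) (hBA : MapsTo e.symm B A)
    {A₂ : Set X₂} {B₂ : Set Y₂} (hAB₂ : MapsTo e₂ A₂ B₂) (hBA₂ : MapsTo e₂.symm B₂ A₂)
    (hf : MapsTo f A A₂) (hg : MapsTo g B B₂) (n : ℕ) (x : relativeSingularHomology R M X A n) :
    xEquiv R M e₂ hAB₂ hBA₂ n (relativeSingularHomology.map R M f hf n x) =
      relativeSingularHomology.map R M g hg n (xEquiv R M e hAB hBA n x) := by
  simp only [xEquiv, LinearEquiv.trans_apply, Iso.toLinearEquiv_apply, Iso.symm_hom]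
  rw [relativeSingularHomology.map_eq_concrete R M f hf n,
    relativeSingularHomology.map_eq_concrete R M g hg n]
  simp only [ModuleCat.comp_apply]
  rw [Iso.inv_hom_id_apply]
  congr 1
  rw [Iso.inv_hom_id_apply]
  refine ComplexXEquiv.homologyEquiv_homologyMap _ _ _ _ (fun i c ↦ ?_) n _
  obtain ⟨c, rfl⟩ := (chainsInSub R M X A).π_f_surjective i c
  rw [relativeConcrete.xEquiv_e_π, Subcomplex.quotMap_f_π_f, Subcomplex.quotMap_f_π_f,
    relativeConcrete.xEquiv_e_π, csingularChainComplex.push_map_f R M e e₂ f g hfg]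

/-- Vanishing of relative homology is invariant under homeomorphisms of pairs across universes. [folklore] -/
theorem isZero_iff_of_homeomorph (e : X ≃ₜ Y) {A : Set X} {B : Set Y} (hAB : MapsTo e A B)
    (hBA : MapsTo e.symm B A) (n : ℕ) :
    IsZero (relativeSingularHomology R M X A n) ↔ IsZero (relativeSingularHomology R M Y B n) :=
  isZero_iff_of_linearEquiv R (xEquiv R M e hAB hBA n)

end relativeSingularHomology

/-! ### Local homology -/

omit [TopologicalSpace X] [TopologicalSpace Y] in
/-- A bijection maps the complement of `K` into the complement of its image. [folklore] -/
lemma mapsTo_compl_image (e : X ≃ Y) (K : Set X) : MapsTo e Kᶜ (e '' K)ᶜ :=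
  fun x (hx : x ∉ K) h ↦ by
    obtain ⟨y, hy, hxy⟩ := h
    exact hx (e.injective hxy ▸ hy)

omit [TopologicalSpace X] [TopologicalSpace Y] in
/-- …and its inverse maps the complement of the image back. [folklore] -/
lemma mapsTo_symm_compl_image (e : X ≃ Y) (K : Set X) : MapsTo e.symm (e '' K)ᶜ Kᶜ :=
  fun y (hy : y ∉ e '' K) h ↦ hy ⟨e.symm y, h, e.apply_symm_apply y⟩

omit [TopologicalSpace X] [TopologicalSpace Y] in
/-- A bijection maps the complement of a point into the complement of its image. [folklore] -/
lemma mapsTo_compl_singleton (e : X ≃ Y) (x : X) : MapsTo e {x}ᶜ {e x}ᶜ :=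
  fun y (hy : y ∉ ({x} : Set X)) h ↦
    hy (mem_singleton_iff.mpr (e.injective (mem_singleton_iff.mp h)))

omit [TopologicalSpace X] [TopologicalSpace Y] in
/-- …and its inverse maps the complement of the image point back. [folklore] -/
lemma mapsTo_symm_compl_singleton (e : X ≃ Y) (x : X) : MapsTo e.symm {e x}ᶜ {x}ᶜ :=
  fun y (hy : y ∉ ({e x} : Set Y)) h ↦ hy (mem_singleton_iff.mpr
    ((e.apply_symm_apply y).symm.trans (congrArg e (mem_singleton_iff.mp h))))

namespace localHomologyOfSet

/-- **Local homology at a set along a homeomorphism across universes**: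
`Hₙ(X | K; M) ≃ₗ[R] Hₙ(Y | e(K); M)` (Hatcher 2002, §3.3 p. 233). [cite: HatcherAT2002, §3.3 p. 233] -/
def xEquiv (e : X ≃ₜ Y) (K : Set X) (n : ℕ) :
    localHomologyOfSet R M X K n ≃ₗ[R] localHomologyOfSet R M Y (e '' K) n :=
  relativeSingularHomology.xEquiv R M e (mapsTo_compl_image e.toEquiv K)
    (mapsTo_symm_compl_image e.toEquiv K) n

/-- Compatibility with the restriction maps `Hₙ(X | K) → Hₙ(X | L)`, `L ⊆ K`. [folklore] -/
theorem xEquiv_restrictLocal (e : X ≃ₜ Y) {K L : Set X} (h : L ⊆ K) (n : ℕ)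
    (x : localHomologyOfSet R M X K n) :
    xEquiv R M e L n (restrictLocal R M h n x) =
      restrictLocal R M (image_mono h) n (xEquiv R M e K n x) :=
  relativeSingularHomology.xEquiv_map R M e e (ContinuousMap.id X) (ContinuousMap.id Y)
    (fun _ ↦ rfl) _ _ _ _ _ _ n x

end localHomologyOfSet

namespace localHomology

/-- **Local homology at a point along a homeomorphism across universes**:
`Hₙ(X | x; M) ≃ₗ[R] Hₙ(Y | e x; M)` (Hatcher 2002, §3.3 p. 231: local homology depends only on
a neighbourhood, up to homeomorphism). [cite: HatcherAT2002, §3.3 p. 231] -/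
def xEquiv (e : X ≃ₜ Y) (x : X) (n : ℕ) :
    localHomology R M X x n ≃ₗ[R] localHomology R M Y (e x) n :=
  relativeSingularHomology.xEquiv R M e (mapsTo_compl_singleton e.toEquiv x)
    (mapsTo_symm_compl_singleton e.toEquiv x) n

/-- Compatibility with restriction from a set to a point. [folklore] -/
theorem xEquiv_restrictToPoint (e : X ≃ₜ Y) {K : Set X} {x : X} (hx : x ∈ K) (n : ℕ)
    (z : localHomologyOfSet R M X K n) :
    xEquiv R M e x n (restrictToPoint R M hx n z) =
      restrictToPoint R M (mem_image_of_mem e hx) n (localHomologyOfSet.xEquiv R M e K n z) :=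
  relativeSingularHomology.xEquiv_map R M e e (ContinuousMap.id X) (ContinuousMap.id Y)
    (fun _ ↦ rfl) _ _ _ _ _ _ n z

/-- Vanishing of local homology is invariant under homeomorphisms across universes. [folklore] -/
theorem isZero_iff_of_homeomorph (e : X ≃ₜ Y) (x : X) (n : ℕ) :
    IsZero (localHomology R M X x n) ↔ IsZero (localHomology R M Y (e x) n) :=
  isZero_iff_of_linearEquiv R (xEquiv R M e x n)

end localHomology

end PartII

end Literature.AlgebraicTopology.SingularHomology
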